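import Summits.AtomisticToContinuum.HydrodynamicLimit.Theorems.InformationPercolationEnginePercolationClosesChaosForecastDefs
import Literature.MathematicalPhysics.KineticTheory.HardSphereEulerProofs
import Mathlib.MeasureTheory.Integral.Prod
import HarnessLib

/-!
# Local equilibrium S5 of the line `equilibrium-forecast-chain-rule` (crux `InformationPercolationEngine.PercolationClosesChaos`,
stmt-AtomisticToContinuum-15178) — piece M: measurability of the coarse one-body functionals of a cell

Support file (`--supports stmt-AtomisticToContinuum-15178`) of the registered stub
`stub_cesaroLocalEquilibrium : PredictableProjection → MesoConditionalEquidistribution → LocalCountUI →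
NoMesoscopicOscillation → CoarseLocalMaxwellianity` (worker S5 of lead c3), equally needed by the transfer S6. The line's
§3 functionals (`pop`, `nbhd`, `kde`, `meanVel`, `temp`, `relEnt`, `inhom`, `Dense`, `Regular`, `GoodUnit`, `relEntAt` of
`…ForecastDefs`) enter `MesoConditionalEquidistribution` under Mathlib's `condExp` — which is the junk `0` on non-integrable
functions — and enter S5/S6 as integrands whose `LG`-expectations are split and compared; both need them MEASURABLE in the phase
point. This file proves it, for every smoothing `ϑ` (no positivity needed):

* `measurable_cellPattern`, `measurable_of_cellPattern` — the cell pattern `w ↦ (cellOf (x_i))_i` takes values in a COUNTABLE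
  discrete type, so any functional that is measurable in `w` for each FIXED pattern is measurable (`measurable_from_prod_countable_left`);
  populations and neighbourhoods are functions of the pattern;
* `measurable_kde_uncurry`, `measurable_meanVel`, `measurable_temp` (jointly in `(w, v)` where relevant), `measurable_relEnt`,
  `measurable_inhom` for FIXED finite populations (parametric Bochner integrals of jointly measurable integrands,
  `StronglyMeasurable.integral_prod_right'`);
* `measurable_relEnt_pop`, `measurable_inhom_pop_nbhd`, `measurableSet_dense`, `measurableSet_regular`, `measurableSet_goodUnit`,
  `measurableSet_pop_nonempty`, `measurableSet_nbhd_nonempty` — the cell functionals of a configuration;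
* `measurable_relEntAt` (registered helper, the headline) and the time-`kΔ` versions along the flow (`measurable_flow`).
-/

noncomputable section

open MeasureTheory Set Filter Topology
open scoped ENNReal BigOperators Classical
open Literature.Analysis.FluidPDE Literature.MathematicalPhysics.KineticTheory
open Literature.MathematicalPhysics.KineticTheory.VelocityBlindPlacement

namespace Summit.AtomisticToContinuum.HydrodynamicLimit.Theorems.EquilibriumForecastLine

variable {N : ℕ}

/-! ## The cell pattern of a configuration -/

/-- The cell pattern `w ↦ (cellOf c σ N (x_i))_i` is measurable (into a countable discrete type). [folklore] -/
theorem measurable_cellPattern (c σ : ℝ) (N : ℕ) :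
    Measurable fun w : Phase N => fun i : Fin (N + 1) => cellOf c σ N (w i).1 :=
  measurable_pi_lambda _ fun i => (Torus.measurable_coarseCell _).comp (measurable_pi_apply i).fst

/-- **Functionals of the cell pattern and the configuration**: if `w ↦ g π w` is measurable for every FIXED pattern `π`, then
`w ↦ g (pattern w) w` is measurable (the pattern type `Fin (N+1) → ℤ³` is countable and discrete). [folklore] -/
theorem measurable_of_cellPattern {β : Type*} [MeasurableSpace β] (c σ : ℝ) {g : (Fin (N + 1) → Cell) → Phase N → β}
    (hg : ∀ π, Measurable (g π)) :
    Measurable fun w : Phase N => g (fun i : Fin (N + 1) => cellOf c σ N (w i).1) w := by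
  have h : Measurable fun p : Phase N × (Fin (N + 1) → Cell) => g p.2 p.1 :=
    measurable_from_prod_countable_left fun π => hg π
  exact h.comp (measurable_id.prodMk (measurable_cellPattern c σ N))

/-- The population of a cell, read off the pattern. [folklore] -/
theorem pop_eq_filter_pattern (c σ : ℝ) (w : Phase N) (q : Cell) :
    pop c σ N w q = Finset.univ.filter fun i => (fun i : Fin (N + 1) => cellOf c σ N (w i).1) i = q := rfl

/-- The neighbourhood population of a cell, read off the pattern. [folklore] -/
theorem nbhd_eq_filter_pattern (c σ : ℝ) (w : Phase N) (q : Cell) :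
    nbhd c σ N w q = Finset.univ.filter fun i =>
      Torus.euclidDist (cellCentre c σ N ((fun i : Fin (N + 1) => cellOf c σ N (w i).1) i)) (cellCentre c σ N q) ≤
        4 * (c * meanFreePath σ N) := rfl

/-! ## The smoothed velocity law, mean velocity and temperature of a FIXED population -/

/-- The velocity of sphere `i`, read off the first component of `(w, v)`, is measurable. [folklore] -/
theorem measurable_vel_fst (i : Fin (N + 1)) : Measurable fun p : Phase N × V3 => (p.1 i).2 := by
  have h : Measurable fun p : Phase N × V3 => p.1 i := (measurable_pi_apply i).comp measurable_fst
  exact h.snd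

/-- One kernel of the estimate, `(w, v) ↦ M_{1, v_i, θ}(v)`, is jointly measurable. [folklore] -/
theorem measurable_localMaxwellian_vel (θ : ℝ) (i : Fin (N + 1)) :
    Measurable fun p : Phase N × V3 => localMaxwellian 1 θ (p.1 i).2 p.2 := by
  have h2 : Measurable fun p : Phase N × V3 => p.2 - (p.1 i).2 := measurable_snd.sub (measurable_vel_fst i)
  unfold localMaxwellian
  exact measurable_const.mul (Real.measurable_exp.comp (((h2.norm.pow_const 2).neg).div_const _))

/-- `kde ϑ w P v` is jointly measurable in `(w, v)` for a fixed population. [folklore] -/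
theorem measurable_kde_uncurry (ϑ : ℝ) (P : Finset (Fin (N + 1))) :
    Measurable fun p : Phase N × V3 => kde ϑ p.1 P p.2 := by
  have h : Measurable fun p : Phase N × V3 => ∑ i ∈ P, localMaxwellian 1 (ϑ ^ 2) (p.1 i).2 p.2 :=
    Finset.measurable_sum P fun i _ => measurable_localMaxwellian_vel (ϑ ^ 2) i
  exact measurable_const.mul h

/-- The velocity of sphere `i` is a measurable function of the configuration. [folklore] -/
theorem measurable_vel (i : Fin (N + 1)) : Measurable fun w : Phase N => (w i).2 := (measurable_pi_apply i).snd

/-- The mean velocity of a fixed population is measurable in the configuration. [folklore] -/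
theorem measurable_meanVel (P : Finset (Fin (N + 1))) : Measurable fun w : Phase N => meanVel w P := by
  unfold meanVel
  exact (Finset.measurable_sum P fun i _ => measurable_vel i).const_smul (((P.card : ℝ))⁻¹)

/-- The temperature of a fixed population is measurable in the configuration. [folklore] -/
theorem measurable_temp (P : Finset (Fin (N + 1))) : Measurable fun w : Phase N => temp w P := by
  unfold temp
  refine measurable_const.mul (Finset.measurable_sum P fun i _ => ?_)
  exact (((measurable_vel i).sub (measurable_meanVel P)).norm.pow_const 2).div_const 3

/-- The reference Maxwellian `M_{1, meanVel, temp + ϑ²}(v)` is jointly measurable in `(w, v)`. [folklore] -/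
theorem measurable_refMaxwellian_uncurry (ϑ : ℝ) (P : Finset (Fin (N + 1))) :
    Measurable fun p : Phase N × V3 => localMaxwellian 1 (temp p.1 P + ϑ ^ 2) (meanVel p.1 P) p.2 := by
  unfold localMaxwellian
  have hθ : Measurable fun p : Phase N × V3 => temp p.1 P + ϑ ^ 2 :=
    ((measurable_temp P).comp measurable_fst).add_const _
  have hu : Measurable fun p : Phase N × V3 => p.2 - meanVel p.1 P :=
    measurable_snd.sub ((measurable_meanVel P).comp measurable_fst)
  refine (measurable_const.mul ((measurable_const.mul hθ).pow_const _)).mul (Real.measurable_exp.comp ?_)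
  exact (hu.norm.pow_const 2).neg.div (measurable_const.mul hθ)

/-- **`w ↦ relEnt ϑ w P` is measurable** for a fixed population (parametric Bochner integral of a jointly measurable
integrand). [folklore] -/
theorem measurable_relEnt (ϑ : ℝ) (P : Finset (Fin (N + 1))) : Measurable fun w : Phase N => relEnt ϑ w P := by
  have hF : Measurable fun p : Phase N × V3 =>
      kde ϑ p.1 P p.2 * Real.log (kde ϑ p.1 P p.2 / localMaxwellian 1 (temp p.1 P + ϑ ^ 2) (meanVel p.1 P) p.2) :=
    (measurable_kde_uncurry ϑ P).mul
      (Real.measurable_log.comp ((measurable_kde_uncurry ϑ P).div (measurable_refMaxwellian_uncurry ϑ P)))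
  exact (hF.stronglyMeasurable.integral_prod_right' (ν := (volume : Measure V3))).measurable

/-- **`w ↦ inhom ϑ w P Q` is measurable** for fixed populations. [folklore] -/
theorem measurable_inhom (ϑ : ℝ) (P Q : Finset (Fin (N + 1))) : Measurable fun w : Phase N => inhom ϑ w P Q := by
  have hF : Measurable fun p : Phase N × V3 => |kde ϑ p.1 P p.2 - kde ϑ p.1 Q p.2| :=
    ((measurable_kde_uncurry ϑ P).sub (measurable_kde_uncurry ϑ Q)).abs
  exact (hF.stronglyMeasurable.integral_prod_right' (ν := (volume : Measure V3))).measurable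

/-! ## The cell functionals of a configuration -/

/-- `w ↦ relEnt ϑ w (pop c σ N w q)` is measurable. [folklore] -/
theorem measurable_relEnt_pop (ϑ c σ : ℝ) (q : Cell) : Measurable fun w : Phase N => relEnt ϑ w (pop c σ N w q) :=
  measurable_of_cellPattern c σ (g := fun π w => relEnt ϑ w (Finset.univ.filter fun i => π i = q))
    fun _ => measurable_relEnt ϑ _

/-- `w ↦ inhom ϑ w (pop c σ N w q) (nbhd c σ N w q)` is measurable. [folklore] -/
theorem measurable_inhom_pop_nbhd (ϑ c σ : ℝ) (q : Cell) :
    Measurable fun w : Phase N => inhom ϑ w (pop c σ N w q) (nbhd c σ N w q) :=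
  measurable_of_cellPattern c σ (g := fun π w => inhom ϑ w (Finset.univ.filter fun i => π i = q)
      (Finset.univ.filter fun i =>
        Torus.euclidDist (cellCentre c σ N (π i)) (cellCentre c σ N q) ≤ 4 * (c * meanFreePath σ N)))
    fun _ => measurable_inhom ϑ _ _

/-- The cardinality of the neighbourhood population is measurable. [folklore] -/
theorem measurable_card_nbhd (c σ : ℝ) (q : Cell) : Measurable fun w : Phase N => ((nbhd c σ N w q).card : ℝ) :=
  measurable_of_cellPattern c σ (g := fun π _ => (((Finset.univ.filter fun i =>
      Torus.euclidDist (cellCentre c σ N (π i)) (cellCentre c σ N q) ≤ 4 * (c * meanFreePath σ N)).card : ℕ) : ℝ))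
    fun _ => measurable_const

/-- The event "cell `q` is occupied" is measurable. [folklore] -/
theorem measurableSet_pop_nonempty (c σ : ℝ) (q : Cell) : MeasurableSet {w : Phase N | (pop c σ N w q).Nonempty} := by
  have h : Measurable fun w : Phase N => (pop c σ N w q).Nonempty :=
    measurable_of_cellPattern c σ (g := fun π _ => (Finset.univ.filter fun i => π i = q).Nonempty) fun _ => measurable_const
  exact measurableSet_setOf.2 h

/-- The event "the neighbourhood of `q` is populated" is measurable. [folklore] -/
theorem measurableSet_nbhd_nonempty (c σ : ℝ) (q : Cell) : MeasurableSet {w : Phase N | (nbhd c σ N w q).Nonempty} := by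
  have h : Measurable fun w : Phase N => (nbhd c σ N w q).Nonempty :=
    measurable_of_cellPattern c σ (g := fun π _ => (Finset.univ.filter fun i =>
      Torus.euclidDist (cellCentre c σ N (π i)) (cellCentre c σ N q) ≤ 4 * (c * meanFreePath σ N)).Nonempty)
      fun _ => measurable_const
  exact measurableSet_setOf.2 h

/-- The packing event `Dense` is measurable. [folklore] -/
theorem measurableSet_dense (φs c σ : ℝ) (q : Cell) : MeasurableSet {w : Phase N | Dense φs c σ N w q} := by
  unfold Dense
  exact measurableSet_lt measurable_const ((measurable_card_nbhd c σ q).mul_const _)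

/-- The regularity event `Regular` is measurable. [folklore] -/
theorem measurableSet_regular (ϑs ϑ φs c σ : ℝ) (q : Cell) :
    MeasurableSet {w : Phase N | Regular ϑs ϑ φs c σ N w q} := by
  unfold Regular
  exact (measurableSet_dense φs c σ q).compl.inter (measurableSet_le (measurable_inhom_pop_nbhd ϑs c σ q) measurable_const)

/-- The good-unit event `GoodUnit` is measurable. [folklore] -/
theorem measurableSet_goodUnit (ϑs ϑ φs c σ : ℝ) (q : Cell) :
    MeasurableSet {w : Phase N | GoodUnit ϑs ϑ φs c σ N w q} := by
  unfold GoodUnit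
  exact (measurableSet_regular ϑs ϑ φs c σ q).inter (measurableSet_le (measurable_relEnt_pop ϑs c σ q) measurable_const)

/-! ## Along the flow -/

/-- **Registered helper `measurable_relEntAt` (piece M of S5/S6): the smoothed relative entropy of a cell at time `t` is a
measurable function of the initial datum** (for every smoothing `ϑs`, scale `c`, time `t`, cell `q`). [folklore] -/
theorem measurable_relEntAt : ∀ {σ : ℝ} {N : ℕ} (Φ : Flow σ N) (ϑs c t : ℝ) (q : Cell), Measurable fun z : Phase N => relEntAt ϑs c σ N Φ t q z := by
  intro σ N Φ ϑs c t q
  exact (measurable_relEnt_pop ϑs c σ q).comp (Φ.measurable_flow t)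

/-- The increment of `MesoConditionalEquidistribution` (b) is measurable, hence (being bounded) integrable under every finite law:
`z ↦ min(relEntAt((k+1)Δ) q z, R) − min(relEntAt(kΔ) q z, R) + κ·𝟙{ϑ ≤ relEntAt(kΔ) q z}`. [folklore] -/
theorem measurable_mceIncrement {σ : ℝ} (Φ : Flow σ N) (ϑs ϑ R κ c : ℝ) (k : ℕ) (q : Cell) :
    Measurable fun z : Phase N =>
      min (relEntAt ϑs c σ N Φ (((k : ℝ) + 1) * stepLen c σ N) q z) R -
        min (relEntAt ϑs c σ N Φ ((k : ℝ) * stepLen c σ N) q z) R +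
        (if ϑ ≤ relEntAt ϑs c σ N Φ ((k : ℝ) * stepLen c σ N) q z then κ else 0) := by
  refine (((measurable_relEntAt Φ ϑs c _ q).min measurable_const).sub
    ((measurable_relEntAt Φ ϑs c _ q).min measurable_const)).add ?_
  exact Measurable.ite (measurableSet_le measurable_const (measurable_relEntAt Φ ϑs c _ q)) measurable_const
    measurable_const

/-- The occupied-and-non-Maxwellian event of `CoarseLocalMaxwellianity` at time `t` is measurable. [folklore] -/
theorem measurableSet_nonMaxwellian {σ : ℝ} (Φ : Flow σ N) (ϑs ϑ c t : ℝ) (q : Cell) :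
    MeasurableSet {z : Phase N | (pop c σ N (Φ.flow t z) q).Nonempty ∧ ϑ < relEntAt ϑs c σ N Φ t q z} :=
  ((measurableSet_pop_nonempty c σ q).preimage (Φ.measurable_flow t)).inter
    (measurableSet_lt measurable_const (measurable_relEntAt Φ ϑs c t q))

/-- The regularity event at time `t` is measurable. [folklore] -/
theorem measurableSet_regular_flow {σ : ℝ} (Φ : Flow σ N) (ϑs ϑ φs c t : ℝ) (q : Cell) :
    MeasurableSet {z : Phase N | Regular ϑs ϑ φs c σ N (Φ.flow t z) q} :=
  (measurableSet_regular ϑs ϑ φs c σ q).preimage (Φ.measurable_flow t)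

/-- The inhomogeneity functional of `NoMesoscopicOscillation` (ii) at time `t` is measurable. [folklore] -/
theorem measurable_inhom_flow {σ : ℝ} (Φ : Flow σ N) (ϑs c t : ℝ) (q : Cell) :
    Measurable fun z : Phase N => inhom ϑs (Φ.flow t z) (pop c σ N (Φ.flow t z) q) (nbhd c σ N (Φ.flow t z) q) :=
  (measurable_inhom_pop_nbhd ϑs c σ q).comp (Φ.measurable_flow t)

end Summit.AtomisticToContinuum.HydrodynamicLimit.Theorems.EquilibriumForecastLine

end
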